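import Mathlib
import Summits.NavierStokesRegularity.NavierStokesRegularity.Theorems.TaoLadderRungThreeGappedFrontRobustSlackRecursion
import Summits.NavierStokesRegularity.NavierStokesRegularity.Theorems.TaoLadderRungThreeGappedFrontRobustStepTransfer
import HarnessLib

/-!
# `TrappingWindowRungThree.TailEnvelopes` (item stmt-NavierStokesRegularity-21748, crux K2) — tools

Elementary helper lemmas for the analytic tail envelopes K2 of route `TrappingWindowRungThree` (rung
TL-M3 of the Tao ladder; MODEL lattice ODEs only — Tao 2016, §4 (4.8)–(4.10) in the cell vocabulary
`TaoCascade.PseudoFlowOn`, `TaoCascade.slackWeight`):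

* `abs_quadTerm_le_three_shell` — the SHELL-RESOLVED size of the quadratic term: if the amplitudes of
  the shells `n-1, n, n+1` are bounded by `a, b, d`, then
  `|quadTerm(X)_{i,n}| ≤ m² ((1+ε₀)^{5n/2} (b² + 2bd) + (1+ε₀)^{5(n-1)/2} a²)` for a table with
  `|α| ≤ 1` on the shift set (the `(0,0,1)` bond is driven by the shell BELOW at its own rate);
* small numeric facts about `2^{1/4}` and `2^{2k}`;
* `slackWeight_behind_le` — the slack weight of the K1/K2 epoch envelope is bounded BEHIND the window,
  uniformly in the number of past epochs, by `ρ · (Cb 2^{(3/4)|k|})²` with an explicit `ρ`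
  (one-step recursion `slackWeight_succ` started from the slack condition WC at the bottom window shell);

HONEST FRAMING: bookkeeping about Tao-type MODEL lattice pseudo-flows; nothing here is a statement about
the Navier–Stokes equations; NS regularity is NOT proved by anything in this file.
-/

noncomputable section

-- the sub-problem namespace repeats the summit name by design (D-0017)
set_option linter.dupNamespace false

namespace Summit.NavierStokesRegularity.NavierStokesRegularity.Theorems

open Set MeasureTheory intervalIntegral Literature.Analysis.FluidPDE
  Literature.Analysis.FluidPDE.TaoCascade GappedFrontRobust

namespace TailEnvelopes

variable {m : ℕ}

/-! ### The shell-resolved size of the quadratic term -/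

/-- **Shell-resolved size of the quadratic term.** If `|X_{j,n-1}(t)| ≤ a`, `|X_{j,n}(t)| ≤ b`,
`|X_{j,n+1}(t)| ≤ d` for all modes `j` and the table has `|α| ≤ 1` on the shift set, then
`|quadTerm(X)_{i,n}(t)| ≤ m² ((1+ε₀)^{5n/2} (b·b + 2 (b·d)) + (1+ε₀)^{5(n-1)/2} (a·a))`
(`ε₀ > -1`): the shifts `(0,0,0), (1,0,0), (0,1,0)` couple the shells `n, n+1` at the rate
`(1+ε₀)^{5n/2}`, the shift `(0,0,1)` couples the shell `n-1` at the rate `(1+ε₀)^{5(n-1)/2}`.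
[cite: Tao2016AveragedNS, §4 (4.8) (the bilinear term on the shift set)] -/
theorem abs_quadTerm_le_three_shell {ε₀ : ℝ} (hε : 0 < 1 + ε₀)
    (α : Fin m → Fin m → Fin m → ℤ × ℤ × ℤ → ℝ)
    (hα : ∀ (i₁ i₂ i₃ : Fin m) (μ : ℤ × ℤ × ℤ), μ ∈ shiftSet → |α i₁ i₂ i₃ μ| ≤ 1)
    (X : Fin m → ℤ → ℝ → ℝ) (i : Fin m) (n : ℤ) (t : ℝ) {a b d : ℝ}
    (ha : ∀ j, |X j (n - 1) t| ≤ a) (hb : ∀ j, |X j n t| ≤ b) (hd : ∀ j, |X j (n + 1) t| ≤ d) :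
    |quadTerm ε₀ α X i n t| ≤
      (m : ℝ) ^ 2 * ((1 + ε₀) ^ ((5 : ℝ) * n / 2) * (b * b + 2 * (b * d)) +
        (1 + ε₀) ^ ((5 : ℝ) * (n - 1 : ℤ) / 2) * (a * a)) := by
  have ha0 : 0 ≤ a := (abs_nonneg _).trans (ha i)
  have hb0 : 0 ≤ b := (abs_nonneg _).trans (hb i)
  have hd0 : 0 ≤ d := (abs_nonneg _).trans (hd i)
  set T : ℝ := (1 + ε₀) ^ ((5 : ℝ) * n / 2) * (b * b + 2 * (b * d)) +
    (1 + ε₀) ^ ((5 : ℝ) * (n - 1 : ℤ) / 2) * (a * a) with hT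
  -- the inner sum over the shift set, for fixed modes
  have hinner : ∀ i₁ i₂ : Fin m,
      |∑ μ ∈ shiftSet, α i₁ i₂ i μ * (1 + ε₀) ^ ((5 : ℝ) * (n - μ.2.2) / 2) *
          (X i₁ (n - μ.2.2 + μ.1) t * X i₂ (n - μ.2.2 + μ.2.1) t)| ≤ T := by
    intro i₁ i₂
    -- generic term bound: |α q Y Z| ≤ q |Y| |Z|
    have hgen : ∀ (μ : ℤ × ℤ × ℤ), μ ∈ shiftSet → ∀ (e : ℝ) (y z : ℝ) {P Q : ℝ},
        |y| ≤ P → |z| ≤ Q → 0 ≤ P →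
        |α i₁ i₂ i μ * (1 + ε₀) ^ e * (y * z)| ≤ (1 + ε₀) ^ e * (P * Q) := by
      intro μ hμ e y z P Q hy hz hP
      have hq : 0 ≤ (1 + ε₀) ^ e := (Real.rpow_pos_of_pos hε _).le
      rw [abs_mul, abs_mul, abs_mul, abs_of_nonneg hq]
      have h1 : |y| * |z| ≤ P * Q := mul_le_mul hy hz (abs_nonneg _) hP
      have h2 : |α i₁ i₂ i μ| * (1 + ε₀) ^ e ≤ 1 * (1 + ε₀) ^ e :=
        mul_le_mul_of_nonneg_right (hα i₁ i₂ i μ hμ) hq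
      calc |α i₁ i₂ i μ| * (1 + ε₀) ^ e * (|y| * |z|)
          ≤ 1 * (1 + ε₀) ^ e * (P * Q) :=
            mul_le_mul h2 h1 (mul_nonneg (abs_nonneg _) (abs_nonneg _)) (by positivity)
        _ = (1 + ε₀) ^ e * (P * Q) := by ring
    rw [shiftSet, Finset.sum_insert (by decide), Finset.sum_insert (by decide),
      Finset.sum_insert (by decide), Finset.sum_singleton]
    simp only [sub_zero, add_zero, Int.cast_zero, Int.cast_one]
    have t0 := hgen (0, 0, 0) (by simp [shiftSet]) ((5 : ℝ) * n / 2) (X i₁ n t) (X i₂ n t)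
      (hb i₁) (hb i₂) hb0
    have t1 := hgen (1, 0, 0) (by simp [shiftSet]) ((5 : ℝ) * n / 2) (X i₁ (n + 1) t) (X i₂ n t)
      (hd i₁) (hb i₂) hd0
    have t2 := hgen (0, 1, 0) (by simp [shiftSet]) ((5 : ℝ) * n / 2) (X i₁ n t) (X i₂ (n + 1) t)
      (hb i₁) (hd i₂) hb0
    have t3 := hgen (0, 0, 1) (by simp [shiftSet]) ((5 : ℝ) * (n - 1 : ℤ) / 2) (X i₁ (n - 1) t)
      (X i₂ (n - 1) t) (ha i₁) (ha i₂) ha0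
    have hcast : ((5 : ℝ) * ((n : ℝ) - 1) / 2) = ((5 : ℝ) * (n - 1 : ℤ) / 2) := by push_cast; ring
    rw [hcast]
    have key : ∀ w x y z : ℝ, |w + (x + (y + z))| ≤ |w| + |x| + |y| + |z| := by
      intro w x y z
      have h1 := abs_add_le w (x + (y + z))
      have h2 := abs_add_le x (y + z)
      have h3 := abs_add_le y z
      linarith
    refine le_trans (key _ _ _ _) ?_
    rw [hT]
    linarith [t0, t1, t2, t3]
  unfold quadTerm
  calc |∑ i₁, ∑ i₂, ∑ μ ∈ shiftSet, α i₁ i₂ i μ * (1 + ε₀) ^ ((5 : ℝ) * (n - μ.2.2) / 2) *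
          (X i₁ (n - μ.2.2 + μ.1) t * X i₂ (n - μ.2.2 + μ.2.1) t)|
      ≤ ∑ i₁, |∑ i₂, ∑ μ ∈ shiftSet, α i₁ i₂ i μ * (1 + ε₀) ^ ((5 : ℝ) * (n - μ.2.2) / 2) *
          (X i₁ (n - μ.2.2 + μ.1) t * X i₂ (n - μ.2.2 + μ.2.1) t)| :=
        Finset.abs_sum_le_sum_abs _ _
    _ ≤ ∑ i₁, ∑ i₂, |∑ μ ∈ shiftSet, α i₁ i₂ i μ * (1 + ε₀) ^ ((5 : ℝ) * (n - μ.2.2) / 2) *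
          (X i₁ (n - μ.2.2 + μ.1) t * X i₂ (n - μ.2.2 + μ.2.1) t)| :=
        Finset.sum_le_sum fun i₁ _ => Finset.abs_sum_le_sum_abs _ _
    _ ≤ ∑ _i₁ : Fin m, ∑ _i₂ : Fin m, T :=
        Finset.sum_le_sum fun i₁ _ => Finset.sum_le_sum fun i₂ _ => hinner i₁ i₂
    _ = (m : ℝ) ^ 2 * T := by
        simp only [Finset.sum_const, Finset.card_univ, Fintype.card_fin]
        ring

/-! ### Numeric facts at scale ratio `2` -/

/-- `(2^{1/4})^4 = 2`. [folklore] -/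
theorem two_rpow_quarter_pow_four : ((2 : ℝ) ^ ((1 : ℝ) / 4)) ^ 4 = 2 := by
  rw [← Real.rpow_natCast, ← Real.rpow_mul zero_le_two]
  norm_num

/-- `1 ≤ 2^{1/4}`. [folklore] -/
theorem one_le_two_rpow_quarter : (1 : ℝ) ≤ (2 : ℝ) ^ ((1 : ℝ) / 4) :=
  Real.one_le_rpow one_le_two (by norm_num)

/-- `59/50 < 2^{1/4}` (as `(59/50)^4 < 2`). [folklore] -/
theorem lt_two_rpow_quarter : (59 / 50 : ℝ) < (2 : ℝ) ^ ((1 : ℝ) / 4) := by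
  have h0 : (0 : ℝ) ≤ (2 : ℝ) ^ ((1 : ℝ) / 4) := Real.rpow_nonneg zero_le_two _
  by_contra hle
  push Not at hle
  have h4 : ((2 : ℝ) ^ ((1 : ℝ) / 4)) ^ 4 ≤ (59 / 50 : ℝ) ^ 4 := pow_le_pow_left₀ h0 hle 4
  rw [two_rpow_quarter_pow_four] at h4
  norm_num at h4

/-- `2^{1/4} ≤ 6/5` (as `2 ≤ (6/5)^4`). [folklore] -/
theorem two_rpow_quarter_le : (2 : ℝ) ^ ((1 : ℝ) / 4) ≤ 6 / 5 := by
  have h0 : (0 : ℝ) ≤ (2 : ℝ) ^ ((1 : ℝ) / 4) := Real.rpow_nonneg zero_le_two _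
  by_contra hle
  push Not at hle
  have h4 : (6 / 5 : ℝ) ^ 4 < ((2 : ℝ) ^ ((1 : ℝ) / 4)) ^ 4 := pow_lt_pow_left₀ hle (by norm_num) (by norm_num)
  rw [two_rpow_quarter_pow_four] at h4
  norm_num at h4

/-- `2^{2k} ≤ 1/4` for an integer `k ≤ -1`. [folklore] -/
theorem two_rpow_two_mul_le_quarter {k : ℤ} (hk : k ≤ -1) :
    (2 : ℝ) ^ ((2 : ℝ) * (k : ℝ)) ≤ 1 / 4 := by
  have hk' : (k : ℝ) ≤ -1 := by exact_mod_cast hk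
  calc (2 : ℝ) ^ ((2 : ℝ) * (k : ℝ)) ≤ (2 : ℝ) ^ (-(2 : ℝ)) :=
        Real.rpow_le_rpow_of_exponent_le one_le_two (by linarith)
    _ = 1 / 4 := by
        rw [Real.rpow_neg zero_le_two, show (2 : ℝ) = ((2 : ℕ) : ℝ) by norm_num, Real.rpow_natCast]
        norm_num

/-- `2^{2k}` is monotone in the integer `k`. [folklore] -/
theorem two_rpow_two_mul_mono {k k' : ℤ} (hk : k ≤ k') :
    (2 : ℝ) ^ ((2 : ℝ) * (k : ℝ)) ≤ (2 : ℝ) ^ ((2 : ℝ) * (k' : ℝ)) := by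
  have hk'' : (k : ℝ) ≤ k' := by exact_mod_cast hk
  exact Real.rpow_le_rpow_of_exponent_le one_le_two (by linarith)


/-- `2^{-3/2} ≤ 3/8` (as `(2^{-3/2})² = 1/8 ≤ 9/64`). [folklore] -/
theorem two_rpow_neg_three_halves_le : (2 : ℝ) ^ (-(3 : ℝ) / 2) ≤ 3 / 8 := by
  have h0 : (0 : ℝ) ≤ (2 : ℝ) ^ (-(3 : ℝ) / 2) := Real.rpow_nonneg zero_le_two _
  have hsq : ((2 : ℝ) ^ (-(3 : ℝ) / 2)) ^ 2 = 1 / 8 := by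
    rw [← Real.rpow_natCast, ← Real.rpow_mul zero_le_two]
    norm_num
  by_contra hle
  push Not at hle
  have h4 : (3 / 8 : ℝ) ^ 2 < ((2 : ℝ) ^ (-(3 : ℝ) / 2)) ^ 2 :=
    pow_lt_pow_left₀ hle (by norm_num) (by norm_num)
  rw [hsq] at h4
  norm_num at h4

/-! ### The slack weight behind the window -/

/-- **The slack weight is bounded behind the window, uniformly in the number of past epochs.** At scale
ratio `2` (`ε₀ = 1`), with ratio exponent `θ ≤ 1/2` and clock `c ≥ 0`, let the epoch envelope be
`env j = 2 (Cb 2^{(3/4)(-j)})²` on the shells `j < -Kb` (`Kb ≥ 0`, `Cb > 0`) and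
`env (-Kb) = ½ Mb² + Wb` (`Wb ≥ 0`) at the bottom window shell (`env ≥ 0` everywhere), where WC gives
`2 · slackWeight L (-Kb) ≤ Wb` for every `L`. Then for every `L` and every `k < -Kb`,
`slackWeight 1 θ c env L k ≤ ρ · (Cb 2^{(3/4)(-k)})²` with `ρ = (c Mb² + (2c+1) Wb)/Cb² + 2c`
(induction on `L` by the one-step recursion `slackWeight_succ`: one shell down costs the factor
`2^{1/2+θ} · 2^{-3/2} ≤ 3/4` against the envelope, and the new epoch term is `≤ (3/8) c` envelopes).
[cite: Tao2016AveragedNS, §6.4 Lemma 6.7 (cumulative energy bound); cell vocabulary] -/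
theorem slackWeight_behind_le {θ c Cb Mb Wb : ℝ} {Kb : ℤ} {env : ℤ → ℝ}
    (hθ' : θ ≤ 1 / 2) (hc : 0 ≤ c) (hCb : 0 < Cb) (hKb : 0 ≤ Kb) (hW : 0 ≤ Wb)
    (henvnn : ∀ j : ℤ, 0 ≤ env j)
    (henv : ∀ j : ℤ, j < -Kb → env j = 2 * (Cb * (2 : ℝ) ^ ((3 : ℝ) / 4 * (-(j : ℝ)))) ^ 2)
    (henv₀ : env (-Kb) = (1 / 2) * Mb ^ 2 + Wb)
    (hWC : ∀ L : ℕ, 2 * slackWeight 1 θ c env L (-Kb) ≤ Wb) :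
    ∀ (L : ℕ) (k : ℤ), k < -Kb →
      slackWeight 1 θ c env L k ≤
        ((c * Mb ^ 2 + (2 * c + 1) * Wb) / Cb ^ 2 + 2 * c) *
          (Cb * (2 : ℝ) ^ ((3 : ℝ) / 4 * (-(k : ℝ)))) ^ 2 := by
  set ρ : ℝ := (c * Mb ^ 2 + (2 * c + 1) * Wb) / Cb ^ 2 + 2 * c with hρ
  set A : ℤ → ℝ := fun k => Cb * (2 : ℝ) ^ ((3 : ℝ) / 4 * (-(k : ℝ))) with hA
  have h2 : (1 + 1 : ℝ) = 2 := one_add_one_eq_two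
  have hBase0 : 0 ≤ c * Mb ^ 2 + (2 * c + 1) * Wb := by positivity
  have hρc : 2 * c ≤ ρ := by
    have : 0 ≤ (c * Mb ^ 2 + (2 * c + 1) * Wb) / Cb ^ 2 := by positivity
    linarith
  have hρ0 : 0 ≤ ρ := by linarith
  have hApos : ∀ k, 0 < A k := fun k => mul_pos hCb (Real.rpow_pos_of_pos two_pos _)
  -- A(k+1)² = 2^{-3/2} A(k)²
  have hAsucc : ∀ k : ℤ, A (k + 1) ^ 2 = (2 : ℝ) ^ (-(3 : ℝ) / 2) * A k ^ 2 := by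
    intro k
    simp only [hA]
    have : (2 : ℝ) ^ ((3 : ℝ) / 4 * (-((k + 1 : ℤ) : ℝ))) =
        (2 : ℝ) ^ ((3 : ℝ) / 4 * (-(k : ℝ))) * (2 : ℝ) ^ (-(3 : ℝ) / 4) := by
      rw [← Real.rpow_add two_pos]; push_cast; ring_nf
    rw [this]
    have h22 : ((2 : ℝ) ^ (-(3 : ℝ) / 4)) ^ 2 = (2 : ℝ) ^ (-(3 : ℝ) / 2) := by
      rw [← Real.rpow_natCast, ← Real.rpow_mul zero_le_two]; norm_num
    rw [← h22]; ring
  -- Cb² ≤ A(k)² for k ≤ -1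
  have hAbig : ∀ k : ℤ, k ≤ -1 → Cb ^ 2 ≤ A k ^ 2 := by
    intro k hk
    have hk' : (1 : ℝ) ≤ -(k : ℝ) := by
      have : (k : ℝ) ≤ -1 := by exact_mod_cast hk
      linarith
    have h1 : (1 : ℝ) ≤ (2 : ℝ) ^ ((3 : ℝ) / 4 * (-(k : ℝ))) :=
      Real.one_le_rpow one_le_two (by nlinarith)
    simp only [hA]
    rw [mul_pow]
    have : Cb ^ 2 * 1 ≤ Cb ^ 2 * ((2 : ℝ) ^ ((3 : ℝ) / 4 * (-(k : ℝ)))) ^ 2 :=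
      mul_le_mul_of_nonneg_left (by nlinarith) (sq_nonneg Cb)
    linarith
  -- the epoch factors at θ ≤ 1/2
  have hq8 : (2 : ℝ) ^ (5 / 2 + θ) ≤ 8 := by
    calc (2 : ℝ) ^ (5 / 2 + θ) ≤ (2 : ℝ) ^ ((3 : ℕ) : ℝ) :=
          Real.rpow_le_rpow_of_exponent_le one_le_two (by push_cast; linarith)
      _ = 8 := by rw [Real.rpow_natCast]; norm_num
  have hq2 : (2 : ℝ) ^ (1 / 2 + θ) ≤ 2 := by
    calc (2 : ℝ) ^ (1 / 2 + θ) ≤ (2 : ℝ) ^ (1 : ℝ) :=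
          Real.rpow_le_rpow_of_exponent_le one_le_two (by linarith)
      _ = 2 := Real.rpow_one 2
  have hq8pos : 0 ≤ (2 : ℝ) ^ (5 / 2 + θ) := Real.rpow_nonneg zero_le_two _
  have hq2pos : 0 ≤ (2 : ℝ) ^ (1 / 2 + θ) := Real.rpow_nonneg zero_le_two _
  have h38 := two_rpow_neg_three_halves_le
  have h38pos : 0 ≤ (2 : ℝ) ^ (-(3 : ℝ) / 2) := Real.rpow_nonneg zero_le_two _
  intro L
  induction L with
  | zero =>
    intro k _
    have : slackWeight 1 θ c env 0 k = 0 := by simp [slackWeight]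
    rw [this]
    exact mul_nonneg hρ0 (sq_nonneg _)
  | succ L ih =>
    intro k hk
    change slackWeight 1 θ c env (L + 1) k ≤ ρ * A k ^ 2
    have hsucc := slackWeight_succ (ε₀ := (1 : ℝ)) (by norm_num) θ c env L k
    rw [h2] at hsucc
    rw [hsucc]
    have hk1 : k ≤ -1 := by omega
    rcases lt_or_eq_of_le (show k + 1 ≤ -Kb by omega) with hlt | heq
    · -- k ≤ -Kb - 2: both terms sit behind the window
      have hk2 : k ≤ -2 := by omega
      have h16 : (2 : ℝ) ^ ((2 : ℝ) * (k : ℝ)) ≤ 1 / 16 := by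
        have hk' : (k : ℝ) ≤ -2 := by exact_mod_cast hk2
        calc (2 : ℝ) ^ ((2 : ℝ) * (k : ℝ)) ≤ (2 : ℝ) ^ (-(4 : ℝ)) :=
              Real.rpow_le_rpow_of_exponent_le one_le_two (by linarith)
          _ = 1 / 16 := by
              rw [Real.rpow_neg zero_le_two, show (2 : ℝ) = ((2 : ℕ) : ℝ) by norm_num,
                show (4 : ℝ) = ((4 : ℕ) : ℝ) by norm_num, Real.rpow_natCast]
              norm_num
      have henv1 : env (k + 1) = 2 * A (k + 1) ^ 2 := by rw [henv (k + 1) hlt]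
      have hih := ih (k + 1) hlt
      rw [henv1]
      have hih' : slackWeight 1 θ c env L (k + 1) ≤ ρ * A (k + 1) ^ 2 := hih
      rw [hAsucc] at hih' ⊢
      have hpow0 : 0 ≤ (2 : ℝ) ^ ((2 : ℝ) * (k : ℝ)) := Real.rpow_nonneg zero_le_two _
      have hA2 : 0 ≤ A k ^ 2 := sq_nonneg _
      -- first term ≤ c · (1/16) · 8 · 2 · (3/8) A² = (3/8) c A²
      have t1 : c * (2 : ℝ) ^ ((2 : ℝ) * (k : ℝ)) *
          ((2 : ℝ) ^ (5 / 2 + θ) * (2 * ((2 : ℝ) ^ (-(3 : ℝ) / 2) * A k ^ 2))) ≤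
          3 / 8 * c * A k ^ 2 := by
        have e1 : c * (2 : ℝ) ^ ((2 : ℝ) * (k : ℝ)) *
            ((2 : ℝ) ^ (5 / 2 + θ) * (2 * ((2 : ℝ) ^ (-(3 : ℝ) / 2) * A k ^ 2))) =
            (2 * c * A k ^ 2) * ((2 : ℝ) ^ ((2 : ℝ) * (k : ℝ)) * (2 : ℝ) ^ (5 / 2 + θ) *
              (2 : ℝ) ^ (-(3 : ℝ) / 2)) := by ring
        rw [e1]
        have hprod : (2 : ℝ) ^ ((2 : ℝ) * (k : ℝ)) * (2 : ℝ) ^ (5 / 2 + θ) *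
            (2 : ℝ) ^ (-(3 : ℝ) / 2) ≤ 1 / 16 * 8 * (3 / 8) :=
          mul_le_mul (mul_le_mul h16 hq8 hq8pos (by norm_num)) h38 h38pos (by norm_num)
        have := mul_le_mul_of_nonneg_left hprod (by positivity : 0 ≤ 2 * c * A k ^ 2)
        linarith
      -- second term ≤ 2 · ρ · (3/8) A² = (3/4) ρ A²
      have t2 : (2 : ℝ) ^ (1 / 2 + θ) * slackWeight 1 θ c env L (k + 1) ≤ 3 / 4 * ρ * A k ^ 2 := by
        have hsw0 : 0 ≤ slackWeight 1 θ c env L (k + 1) :=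
          slackWeight_nonneg (by norm_num) hc henvnn L (k + 1)
        calc (2 : ℝ) ^ (1 / 2 + θ) * slackWeight 1 θ c env L (k + 1)
            ≤ 2 * (ρ * ((2 : ℝ) ^ (-(3 : ℝ) / 2) * A k ^ 2)) :=
              mul_le_mul hq2 hih' hsw0 (by norm_num)
          _ ≤ 2 * (ρ * (3 / 8 * A k ^ 2)) := by
              have := mul_le_mul_of_nonneg_right h38 hA2
              nlinarith
          _ = 3 / 4 * ρ * A k ^ 2 := by ring
      have t3 : (3 / 8 * c + 3 / 4 * ρ) * A k ^ 2 ≤ ρ * A k ^ 2 :=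
        mul_le_mul_of_nonneg_right (by linarith) hA2
      linarith [t1, t2, t3]
    · -- k = -Kb - 1: the bottom window shell feeds the first behind shell
      have hk' : k + 1 = -Kb := heq
      rw [hk', henv₀]
      have h4 := two_rpow_two_mul_le_quarter hk1
      have hpow0 : 0 ≤ (2 : ℝ) ^ ((2 : ℝ) * (k : ℝ)) := Real.rpow_nonneg zero_le_two _
      have hsw := hWC L
      have henv0 : 0 ≤ (1 / 2) * Mb ^ 2 + Wb := by positivity
      have t1 : c * (2 : ℝ) ^ ((2 : ℝ) * (k : ℝ)) * ((2 : ℝ) ^ (5 / 2 + θ) * ((1 / 2) * Mb ^ 2 + Wb)) ≤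
          2 * c * ((1 / 2) * Mb ^ 2 + Wb) := by
        have hprod : (2 : ℝ) ^ ((2 : ℝ) * (k : ℝ)) * (2 : ℝ) ^ (5 / 2 + θ) ≤ 1 / 4 * 8 :=
          mul_le_mul h4 hq8 hq8pos (by norm_num)
        have := mul_le_mul_of_nonneg_left hprod (by positivity : 0 ≤ c * ((1 / 2) * Mb ^ 2 + Wb))
        nlinarith
      have hsw0 : 0 ≤ slackWeight 1 θ c env L (-Kb) :=
        slackWeight_nonneg (by norm_num) hc henvnn L (-Kb)
      have t2 : (2 : ℝ) ^ (1 / 2 + θ) * slackWeight 1 θ c env L (-Kb) ≤ Wb := by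
        have := mul_le_mul hq2 (le_refl (slackWeight 1 θ c env L (-Kb))) hsw0 (by norm_num)
        linarith
      have hA := hAbig k hk1
      have hCb2 : 0 < Cb ^ 2 := by positivity
      have hρA : c * Mb ^ 2 + (2 * c + 1) * Wb ≤ ρ * A k ^ 2 := by
        have e1 : ρ * A k ^ 2 = (c * Mb ^ 2 + (2 * c + 1) * Wb) / Cb ^ 2 * A k ^ 2 + 2 * c * A k ^ 2 := by
          rw [hρ]; ring
        rw [e1]
        have h1 : c * Mb ^ 2 + (2 * c + 1) * Wb ≤ (c * Mb ^ 2 + (2 * c + 1) * Wb) / Cb ^ 2 * A k ^ 2 := by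
          rw [div_mul_eq_mul_div, le_div_iff₀ hCb2]
          exact mul_le_mul_of_nonneg_left hA hBase0
        nlinarith [sq_nonneg (A k)]
      linarith [t1, t2, hρA]


end TailEnvelopes

end Summit.NavierStokesRegularity.NavierStokesRegularity.Theorems

end
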